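import Literature.AnabelianGeometry.EtaleTheta.Discharge.Sec3Prop34CnstOfRlfRNegative
import HarnessLib

/-!
# [EtTh] Prop. 3.4 as typed (`DivisorMonoids.Prop34`): a SCHEMA over abstract data — kernel truth table
# (FACT-LIST row F-2490; proof-only companion of `DivisorMonoids.lean`)

Mochizuki, *The étale theta function …*, Publ. RIMS **45** (2009) [EtTh], §3, Prop. 3.4 "(Divisor and Rational
Function Monoids)", PRIMS PDF p. 74 (printed 300) [cite: MochizukiEtTh2009, Prop 3.4 p.74]: (i) "`Φ₀(Y^log)` [is]
perf-factorial … every endomorphism of `Φ₀(Y^log)` … induced by an endomorphism of `Y^log` over `X^log` is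
non-dilating … the functor `Φ₀` defines a divisorial monoid on `D₀`"; (ii) "`O_L^× ≅ Ker(B₀(Y^log) → Φ₀^gp(Y^log))`;
`O_L^▷ ≅ B₀(Y^log) ×_{Φ₀^gp(Y^log)} Φ₀(Y^log)`; `L^× ≅ F₀(Y^log)`".

PROOF-ONLY file (abc-iut cell, block F fact-proving wave, seat abc-iut-f-117, tranche 117; FACT-LIST row
**F-2490** `Literature.AnabelianGeometry.EtaleTheta.DivisorMonoids.Prop34`, kernel_closedness = parametrised).
abc-iut-L2-t3's `DivisorMonoids.Prop34 T V V₀` is a `Prop`-valued STRUCTURE over (a) the Def. 3.3 (iii) OUTPUT DATA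
`T : DivisorMonoids D₀` (abstract functors `Φ₀`, `B₀`, `B₀ → Φ₀^gp`, `F₀`; the inductive-limit construction over the
`Δ^fil`-closures is not carried out in the tree) and (b) two VOCABULARY STUBS `V : FrdIMonoidStub`,
`V₀ : FrdICatStub D₀` whose fields are ARBITRARY predicates.  In print Prop. 3.4 is a theorem about the geometric
`Φ₀`, `B₀`; over the abstract data it is "what an instance must supply" (trunk docstring).  This file records the
kernel truth table the FACT-LIST asks for (plan header rule R1, 2026-08-26):

* **universal closure REFUTED** — `DivisorMonoids.not_forall_prop34`: `¬ ∀ D₀ T V V₀, T.Prop34 V V₀`; indeed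
  FIBREWISE, for EVERY datum `T` and every monoid vocabulary `V` there is a category vocabulary `V₀` (the slot
  "divisorial monoid on `D₀`" read as `False`) with `¬ T.Prop34 V V₀` (`exists_frdICatStub_not_prop34`), and for every
  `T` over a category with an object and every `V₀` there is a monoid vocabulary `V` ("perf-factorial" read as
  `False`) with `¬ T.Prop34 V V₀` (`exists_frdIMonoidStub_not_prop34`);
* **content isolation** — at the all-`True` vocabularies `⊤`, `T.Prop34 ⊤ ⊤` is EQUIVALENT to the two clauses of
  (ii) that carry content on the data `T` ("kernel of `B₀ → Φ₀^gp` ⊆ `F₀`", "effective locus ⊆ `F₀`") —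
  `prop34_top_iff` — and these are exactly the fields the cone's consumers use (`Prop34.ker_div₀_le_F₀`,
  `Prop34.mem_F₀_of_div₀_mem` in `Discharge/Sec3Prop34CnstOfRlfZ.lean`, `…OfRlfQ.lean`, which take `h34 : dm.Prop34 V V₀`
  as a HYPOTHESIS); the two clauses are NOT automatic on abstract data (`exists_not_prop34_top`: `B₀ = ℤ`, `Φ₀ = 1`,
  `F₀ = 1` over the one-object category) and they HOLD for some data (`exists_prop34_top`);
* **model witness (non-vacuity over the tree's real [FrdI] vocabulary)** — IN TREE, by name:
  `Sec3Prop34CnstOfRlfRNegative.prop34` (abc-iut-w5-d164: `Φ₀ = ℝ_{≥0}³`, `B₀ = ℤ²`, `F₀ = 0` over `Discrete PUnit`,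
  vocabularies `treeMonoidVocab` / `treeCatVocab`); re-exported here as `exists_prop34_treeVocab`.

So F-2490 is a SCHEMA: false as a universal closure, consistent, and consumed only as a hypothesis; its instance
at the GEOMETRIC Def. 3.3 (iii) data is not constructible in the tree (the data are not constructed:
TODO-merge(abc-iut-L3-t2), tower of universal combinatorial coverings; the printed proof rests on Prop. 3.2 and
Raynaud's formal-scheme divisor theory).  HONEST FRAMING: statements about the TYPED schema over abstract data; nothing
of [EtTh] is asserted or denied; no side is taken on [IUTchIII] Cor. 3.12; typed ≠ proved.  No definitions, no
instances, no Prop facts.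
-/

namespace Literature.AnabelianGeometry.EtaleTheta

open CategoryTheory Opposite Literature.AlgebraicGeometry.Frobenioids

namespace DivisorMonoids

universe u v w

section Fibrewise

variable {D₀ : Type u} [Category.{v} D₀] (T : DivisorMonoids.{u, v, w} D₀)

/-- If the category vocabulary does not call `Φ₀` a divisorial monoid on `D₀`, Prop. 3.4 (i) as typed fails.
[cite: MochizukiEtTh2009, Prop 3.4 p.74] -/
theorem not_prop34_of_not_isDivisorialOn (V : FrdIMonoidStub.{w}) (V₀ : FrdICatStub.{u, v, w} D₀)
    (h : ¬ V₀.IsDivisorialOn T.Φ₀) : ¬ T.Prop34 V V₀ :=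
  fun h34 => h h34.isDivisorialOn

/-- If the monoid vocabulary does not call some `Φ₀(Y)` perf-factorial, Prop. 3.4 (i) as typed fails.
[cite: MochizukiEtTh2009, Prop 3.4 p.74] -/
theorem not_prop34_of_not_isPerfFactorial (V : FrdIMonoidStub.{w}) (V₀ : FrdICatStub.{u, v, w} D₀) (Y : D₀ᵒᵖ)
    (h : ¬ V.IsPerfFactorial (T.Φ₀.obj Y)) : ¬ T.Prop34 V V₀ :=
  fun h34 => h (h34.isPerfFactorial Y)

/-- **Fibrewise refutation, category slot**: for EVERY Def. 3.3 (iii) datum `T` and every monoid vocabulary `V`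
there is a category vocabulary `V₀` ("divisorial monoid on `D₀`" := `False`) with `¬ T.Prop34 V V₀`.
[cite: MochizukiEtTh2009, Prop 3.4 p.74] -/
theorem exists_frdICatStub_not_prop34 (V : FrdIMonoidStub.{w}) :
    ∃ V₀ : FrdICatStub.{u, v, w} D₀, ¬ T.Prop34 V V₀ :=
  ⟨⟨fun _ => False, fun _ => True, fun _ => True⟩,
    T.not_prop34_of_not_isDivisorialOn V _ (fun h => h)⟩

/-- **Fibrewise refutation, monoid slot**: for EVERY datum `T` over a category with an object and every category
vocabulary `V₀` there is a monoid vocabulary `V` ("perf-factorial" := `False`) with `¬ T.Prop34 V V₀`.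
[cite: MochizukiEtTh2009, Prop 3.4 p.74] -/
theorem exists_frdIMonoidStub_not_prop34 [Nonempty D₀] (V₀ : FrdICatStub.{u, v, w} D₀) :
    ∃ V : FrdIMonoidStub.{w}, ¬ T.Prop34 V V₀ :=
  ⟨⟨fun _ _ => False, fun _ _ _ _ _ => True, fun _ _ => True, fun _ _ _ => True⟩,
    T.not_prop34_of_not_isPerfFactorial _ V₀ (op (Classical.arbitrary D₀)) (fun h => h)⟩

/-- Hence, for every datum `T` and every `V`, Prop. 3.4 as typed is NOT true for all category vocabularies.
[cite: MochizukiEtTh2009, Prop 3.4 p.74] -/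
theorem not_forall_frdICatStub_prop34 (V : FrdIMonoidStub.{w}) :
    ¬ ∀ V₀ : FrdICatStub.{u, v, w} D₀, T.Prop34 V V₀ := by
  obtain ⟨V₀, hV₀⟩ := T.exists_frdICatStub_not_prop34 V
  exact fun h => hV₀ (h V₀)

/-! ### Content isolation: the all-`True` vocabularies -/

/-- **At the all-`True` vocabularies, Prop. 3.4 as typed is exactly its two (ii) clauses on the data**:
"a log-meromorphic function with trivial divisor is constant" and "a log-meromorphic function with effective
divisor is constant" (`O_L^× ≅ Ker(B₀ → Φ₀^gp)`, `O_L^▷ ≅ B₀ ×_{Φ₀^gp} Φ₀`, both inside `F₀ ≅ L^×`).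
[cite: MochizukiEtTh2009, Prop 3.4 (ii) p.74] -/
theorem prop34_top_iff :
    T.Prop34 ⟨fun _ _ => True, fun _ _ _ _ _ => True, fun _ _ => True, fun _ _ _ => True⟩
        ⟨fun _ => True, fun _ => True, fun _ => True⟩ ↔
      (∀ (Y : D₀ᵒᵖ) (b : T.B₀.obj Y), T.div₀ Y b = 1 → b ∈ T.F₀ Y) ∧
        ∀ (Y : D₀ᵒᵖ) (b : T.B₀.obj Y) (x : T.Φ₀.obj Y),
          T.div₀ Y b = Algebra.GrothendieckGroup.of x → b ∈ T.F₀ Y :=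
  ⟨fun h => ⟨h.ker_div₀_le_F₀, h.mem_F₀_of_div₀_mem⟩,
    fun h => ⟨fun _ => trivial, fun _ _ => trivial, trivial, h.1, h.2⟩⟩

/-- The second (ii) clause implies the first (`1 = of 1` is an effective divisor).
[cite: MochizukiEtTh2009, Prop 3.4 (ii) p.74] -/
theorem ker_div₀_le_F₀_of_mem_F₀_of_div₀_mem
    (h : ∀ (Y : D₀ᵒᵖ) (b : T.B₀.obj Y) (x : T.Φ₀.obj Y), T.div₀ Y b = Algebra.GrothendieckGroup.of x → b ∈ T.F₀ Y)
    (Y : D₀ᵒᵖ) (b : T.B₀.obj Y) (hb : T.div₀ Y b = 1) : b ∈ T.F₀ Y :=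
  h Y b 1 (by rw [hb, map_one])

/-- So at the all-`True` vocabularies Prop. 3.4 as typed is the single clause "effective divisor ⇒ constant".
[cite: MochizukiEtTh2009, Prop 3.4 (ii) p.74] -/
theorem prop34_top_iff_effective :
    T.Prop34 ⟨fun _ _ => True, fun _ _ _ _ _ => True, fun _ _ => True, fun _ _ _ => True⟩
        ⟨fun _ => True, fun _ => True, fun _ => True⟩ ↔
      ∀ (Y : D₀ᵒᵖ) (b : T.B₀.obj Y) (x : T.Φ₀.obj Y),
        T.div₀ Y b = Algebra.GrothendieckGroup.of x → b ∈ T.F₀ Y := by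
  rw [prop34_top_iff]
  exact ⟨fun h => h.2, fun h => ⟨T.ker_div₀_le_F₀_of_mem_F₀_of_div₀_mem h, h⟩⟩

/-- If every log-meromorphic function is declared constant (`F₀ = B₀`), Prop. 3.4 holds at the all-`True`
vocabularies — the cheapest positive instance of the schema on given `Φ₀`, `B₀`, `div₀`.
[cite: MochizukiEtTh2009, Prop 3.4 (ii) p.74] -/
theorem prop34_top_of_F₀_eq_top (hF : ∀ Y : D₀ᵒᵖ, T.F₀ Y = ⊤) :
    T.Prop34 ⟨fun _ _ => True, fun _ _ _ _ _ => True, fun _ _ => True, fun _ _ _ => True⟩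
      ⟨fun _ => True, fun _ => True, fun _ => True⟩ :=
  T.prop34_top_iff_effective.mpr fun Y b _ _ => by rw [hF Y]; exact Submonoid.mem_top b

end Fibrewise

/-! ### Universe-`0` closed instances over the one-object base category -/

section Closed

open Sec3Prop34CnstOfRlfRNegative in
/-- **Model witness (in tree, abc-iut-w5-d164), re-exported**: Prop. 3.4 as typed HOLDS for the data `dm₀`
(`Φ₀ = ℝ_{≥0}³`, `B₀ = ℤ²`, `F₀ = 0` over `Discrete PUnit`) over the TREE's [FrdI] vocabularies — the schema is
consistent with the real notions "perf-factorial", "non-dilating", "divisorial monoid on `D₀`".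
[cite: MochizukiEtTh2009, Prop 3.4 p.74] -/
theorem exists_prop34_treeVocab :
    ∃ (T : DivisorMonoids.{0, 0, 0} (Discrete PUnit.{1})),
      ∀ IsRat IsSRat : ((Discrete PUnit.{1})ᵒᵖ ⥤ CommMonCat.{0}) → Prop,
        T.Prop34 treeMonoidVocab (treeCatVocab (Discrete PUnit.{1}) IsRat IsSRat) :=
  ⟨dm₀, prop34⟩

open Sec3Prop34CnstOfRlfRNegative in
/-- The data `dm₀` also satisfy Prop. 3.4 at the all-`True` vocabularies (its (ii) clauses hold: `F₀ = 0` and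
`B₀ → Φ₀^gp` has trivial kernel and trivial effective locus). [cite: MochizukiEtTh2009, Prop 3.4 (ii) p.74] -/
theorem exists_prop34_top :
    ∃ T : DivisorMonoids.{0, 0, 0} (Discrete PUnit.{1}),
      T.Prop34 ⟨fun _ _ => True, fun _ _ _ _ _ => True, fun _ _ => True, fun _ _ _ => True⟩
        ⟨fun _ => True, fun _ => True, fun _ => True⟩ :=
  ⟨dm₀, dm₀.prop34_top_iff.mpr
    ⟨(prop34 (fun _ => True) (fun _ => True)).ker_div₀_le_F₀,
      (prop34 (fun _ => True) (fun _ => True)).mem_F₀_of_div₀_mem⟩⟩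

/-- **The (ii) clauses have content on abstract data**: over the one-object category take `Φ₀ = 1` (so
`Φ₀^gp = 1` and every divisor is trivial and effective), `B₀ = ℤ`, `F₀ = 1`; then the non-constant function
`1 ∈ ℤ` has trivial divisor, so Prop. 3.4 FAILS even at the all-`True` vocabularies.
[cite: MochizukiEtTh2009, Prop 3.4 (ii) p.74] -/
theorem exists_not_prop34_top :
    ∃ T : DivisorMonoids.{0, 0, 0} (Discrete PUnit.{1}),
      ¬ T.Prop34 ⟨fun _ _ => True, fun _ _ _ _ _ => True, fun _ _ => True, fun _ _ _ => True⟩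
        ⟨fun _ => True, fun _ => True, fun _ => True⟩ := by
  let T : DivisorMonoids.{0, 0, 0} (Discrete PUnit.{1}) :=
    { Φ₀ := (Functor.const _).obj (CommMonCat.of PUnit.{1})
      B₀ := (Functor.const _).obj (CommMonCat.of (Multiplicative ℤ))
      isUnit_B₀ := fun _ b => by
        change IsUnit (M := Multiplicative ℤ) b
        exact Group.isUnit _
      div₀ := fun _ => 1
      div₀_natural := fun _ _ => by rw [MonoidHom.one_apply, MonoidHom.one_apply, map_one]
      F₀ := fun _ => ⊥
      F₀_map := fun f b hb => by
        rw [Submonoid.mem_bot] at hb ⊢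
        rw [hb, map_one]
      ncsp₀ := fun _ => ⊤
      csp₀ := fun _ => ⊥
      ncsp₀_map := fun _ _ _ => trivial
      csp₀_map := fun _ x hx => by
        rw [Submonoid.mem_bot] at hx ⊢
        rw [hx, map_one]
      existsUnique_ncsp_csp := fun _ x => by
        refine ⟨(⟨x, trivial⟩, ⟨1, Submonoid.mem_bot.mpr rfl⟩), mul_one x, ?_⟩
        rintro ⟨a, c⟩ h
        have hc : c.1 = 1 := Submonoid.mem_bot.mp c.2
        have ha : a.1 = x := by
          have h' : a.1 * c.1 = x := h
          rwa [hc, mul_one] at h'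
        exact Prod.ext (Subtype.ext ha) (Subtype.ext hc) }
  refine ⟨T, fun h34 => ?_⟩
  have h1 : (Multiplicative.ofAdd (1 : ℤ) : Multiplicative ℤ) ∈
      (⊥ : Submonoid (Multiplicative ℤ)) :=
    h34.ker_div₀_le_F₀ (op ⟨PUnit.unit⟩) (Multiplicative.ofAdd (1 : ℤ)) rfl
  rw [Submonoid.mem_bot] at h1
  exact one_ne_zero (Multiplicative.ofAdd.injective h1 : (1 : ℤ) = 0)

/-- **F-2490, universal closure REFUTED** (universe-`0` instance of the closure): Prop. 3.4 as typed is not true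
for all data and all vocabularies — already the data `dm₀` with "divisorial monoid on `D₀`" := `False` fail it.
[cite: MochizukiEtTh2009, Prop 3.4 p.74] -/
theorem not_forall_prop34 :
    ¬ ∀ (D₀ : Type) [Category.{0} D₀] (T : DivisorMonoids.{0, 0, 0} D₀) (V : FrdIMonoidStub.{0})
        (V₀ : FrdICatStub.{0, 0, 0} D₀), T.Prop34 V V₀ :=
  fun h => Sec3Prop34CnstOfRlfRNegative.dm₀.not_forall_frdICatStub_prop34 treeMonoidVocab
    (h _ Sec3Prop34CnstOfRlfRNegative.dm₀ treeMonoidVocab)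

/-- **Independence at fixed vocabularies**: at the all-`True` vocabularies SOME Def. 3.3 (iii) datum satisfies
Prop. 3.4 as typed and SOME datum fails it — the (ii) clauses are a genuine constraint on the data, neither
automatic nor contradictory. [cite: MochizukiEtTh2009, Prop 3.4 p.74] -/
theorem prop34_top_independent :
    (∃ T : DivisorMonoids.{0, 0, 0} (Discrete PUnit.{1}),
        T.Prop34 ⟨fun _ _ => True, fun _ _ _ _ _ => True, fun _ _ => True, fun _ _ _ => True⟩
          ⟨fun _ => True, fun _ => True, fun _ => True⟩) ∧
      ∃ T : DivisorMonoids.{0, 0, 0} (Discrete PUnit.{1}),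
        ¬ T.Prop34 ⟨fun _ _ => True, fun _ _ _ _ _ => True, fun _ _ => True, fun _ _ _ => True⟩
          ⟨fun _ => True, fun _ => True, fun _ => True⟩ :=
  ⟨exists_prop34_top, exists_not_prop34_top⟩

end Closed

end DivisorMonoids

end Literature.AnabelianGeometry.EtaleTheta
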